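import Summits.Parity.BatemanHorn.Theorems.SoloInformedSystemPsiK

/-!
# SoloInformedBatemanHornPsiKForm — the conjunct `BatemanHorn` as a family of `ψ_k` prime number theorems

Solo unit `solo-Parity-informed` (informed mode), session 16; `PLAN.md` §24, CLAIMS C74.

`Summit.Parity.BatemanHorn` is by definition `Literature.NumberTheory.Sieve.BatemanHornConjecture =
∀ k (f : Fin k → ℤ[X]), IsBatemanHornSystem f → BatemanHornAsymptotic f`.  The empty system (`k = 0`)
satisfies the asymptotic trivially (`batemanHornAsymptotic_of_isEmpty`: constant `1`, count `x + 1 ~ x`), and for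
`k ≥ 1` session 16's `batemanHornAsymptotic_iff_isEquivalent_psiK_fin` applies, so

  `BatemanHornConjecture ⟺ ∀ k (f : Fin (k+1) → ℤ[X]), IsBatemanHornSystem f →
      ∑_{1 ≤ n ≤ x} Λ_{k+1}(|∏ᵢ fᵢ(n)|) ~ (k+1)! · batemanHornConst f · x`

(`batemanHornConjecture_iff_forall_psiK`): the conjunct is exactly a family of prime number theorems, one
generalised von Mangoldt divisor sum along one integer polynomial each.
-/

namespace Summit.Parity.BatemanHorn.Theorems

open Finset Filter ArithmeticFunction Asymptotics Polynomial
open scoped Topology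
open Literature.NumberTheory.Sieve (IsBatemanHornSystem batemanHornConst BatemanHornAsymptotic
  BatemanHornConjecture HasBatemanHornConst batemanHornPartial polyPrimeCount polyRootCountMod
  generalizedVonMangoldt)

variable {ι : Type*} [Fintype ι]

/-- The empty system has no roots modulo any prime. -/
theorem polyRootCountMod_of_isEmpty [IsEmpty ι] (f : ι → ℤ[X]) {p : ℕ} (hp : p.Prime) :
    polyRootCountMod f p = 0 := by
  rw [polyRootCountMod, card_eq_zero, filter_eq_empty_iff]
  intro n _
  rw [Fintype.prod_empty]
  have h1 : (1 : ℤ) < p := by exact_mod_cast hp.one_lt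
  exact fun h => absurd (Int.eq_one_of_dvd_one (by omega) h) (by omega)

/-- The empty system has Bateman–Horn constant `1`. -/
theorem hasBatemanHornConst_one_of_isEmpty [IsEmpty ι] (f : ι → ℤ[X]) : HasBatemanHornConst f 1 := by
  have h : batemanHornPartial f = fun _ => 1 := by
    funext x
    rw [batemanHornPartial]
    refine prod_eq_one fun p hp => ?_
    rw [polyRootCountMod_of_isEmpty f (Nat.mem_primesLE.mp hp).2, Fintype.card_eq_zero, pow_zero,
      Nat.cast_zero, zero_div, sub_zero, mul_one]
  rw [HasBatemanHornConst, h]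
  exact tendsto_const_nhds

/-- The empty system counts every `n ≤ x`. -/
theorem polyPrimeCount_of_isEmpty [IsEmpty ι] (f : ι → ℤ[X]) (x : ℕ) : polyPrimeCount f x = x + 1 := by
  rw [polyPrimeCount, filter_true_of_mem fun n _ => fun i => isEmptyElim i, card_range]

/-- **The Bateman–Horn asymptotic holds (trivially) for the empty system.** -/
theorem batemanHornAsymptotic_of_isEmpty [IsEmpty ι] (f : ι → ℤ[X]) : BatemanHornAsymptotic f := by
  refine ⟨1, hasBatemanHornConst_one_of_isEmpty f, ?_⟩
  have e : (fun x : ℕ => (1 : ℝ) / (∏ i, ((f i).natDegree : ℝ)) * (x : ℝ) / Real.log x ^ Fintype.card ι)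
      = fun x : ℕ => (x : ℝ) := by
    funext x
    rw [Fintype.prod_empty, Fintype.card_eq_zero, pow_zero, div_one, div_one, one_mul]
  rw [e]
  have e2 : (fun x : ℕ => (polyPrimeCount f x : ℝ)) = fun x : ℕ => (x : ℝ) + 1 := by
    funext x
    rw [polyPrimeCount_of_isEmpty, Nat.cast_add, Nat.cast_one]
  rw [e2]
  refine (IsEquivalent.refl).add_isLittleO ?_
  rw [isLittleO_one_left_iff]
  simpa only [Real.norm_eq_abs, Nat.abs_cast] using tendsto_natCast_atTop_atTop (R := ℝ)

/-- **`BatemanHorn` ⟺ a family of `ψ_k` prime number theorems.**  The Bateman–Horn conjecture (the conjunct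
`Summit.Parity.BatemanHorn`, definitionally `BatemanHornConjecture`) holds iff for every `k` and every Bateman–Horn
system `f : Fin (k+1) → ℤ[X]`, `∑_{1 ≤ n ≤ x} Λ_{k+1}(|∏ᵢ fᵢ(n)|) ~ (k+1)! · batemanHornConst f · x`. -/
theorem batemanHornConjecture_iff_forall_psiK :
    BatemanHornConjecture ↔ ∀ (k : ℕ) (f : Fin (k + 1) → ℤ[X]), IsBatemanHornSystem f →
      (fun x : ℕ => ∑ n ∈ Icc 1 x,
          generalizedVonMangoldt (k + 1) ((∏ i, f i).eval (n : ℤ)).natAbs) ~[atTop]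
        fun x : ℕ => ((k + 1).factorial : ℝ) * batemanHornConst f * (x : ℝ) := by
  constructor
  · intro h k f hf
    exact (batemanHornAsymptotic_iff_isEquivalent_psiK_fin k.succ_ne_zero hf).mp (h (k + 1) f hf)
  · intro h k f hf
    cases k with
    | zero => exact batemanHornAsymptotic_of_isEmpty f
    | succ k => exact (batemanHornAsymptotic_iff_isEquivalent_psiK_fin k.succ_ne_zero hf).mpr (h k f hf)

end Summit.Parity.BatemanHorn.Theorems
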